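import Literature.MathematicalPhysics.QuantumFieldTheory.Balaban1983to89.Beta.RemainderData190TowerFlat
import Literature.MathematicalPhysics.QuantumFieldTheory.Balaban1983to89.Beta.RemainderOriginTowerDelta2Plaquette

/-!
# T. Bałaban, *Renormalization group approach to lattice gauge field theories. I*, Commun. Math. Phys. **109** (1987) 249–301 [Balaban1987RG1] p. 282 and
# (4.35) p. 290 ⟵ [Balaban1985Variational] (182) p. 307, (190) p. 308 and [Balaban1985BackgroundPropagators] (3.35)–(3.37) p. 396, Thm 3.11 p. 416, (3.126)
# p. 420, (3.132)–(3.138) pp. 422–423: **THE (190)-SOCKET `Data190` OF ROW (D4) INHABITED ON THE BOND-FIELD CARRIERS OF THE TOWER IN A BACKGROUND FIELD OF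
# PRINT's SMALL-FIELD CLASS, WITH BAŁABAN's `Δ⁽²⁾(U)` BUILT IN AND THE DISPLAY ∕ WITNESSES DERIVED — `(δ∕δB)𝓗(0) := H₀ + G̃Δ⁽²⁾H₀` of (182) at the origin** —
# «Y21» `Beta.RemainderOriginTowerDelta2Plaquette.exists_ineq190_origin_tower_delta2_plaquette` plugged into «Y19»
# `Beta.RemainderData190TowerFlat.exists_data190_tower_of_ineq190` (this lineage gen 115, «Y22»; the display-free twin of «Y20»)

CITATION HEADER (lean-in-tree rule 2026-08-18).  Audit cell `pub-balaban`, BINDER row (D4) (`RemainderConst` leaves for Bałaban's split), OWNER lineage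
`b2b-balaban-beta-an4`, gen 115.  Loci exactly as in «Y21», «Y18» and «Y19» (this lineage): [Balaban1987RG1] ([I]; held `paper:balaban1987-cmp109-rg-i-small-field`)
(4.4) p. 281, p. 282, (4.35) p. 290; [Balaban1985Variational] ([15]; `paper:balaban1985-cmp102-variational-background`) (129)–(131) pp. 297–298, (180) p. 306,
(182) p. 307, (190) p. 308; [Balaban1985BackgroundPropagators] ([5]; `paper:balaban1985-cmp99-background-propagators`) (3.11) p. 392, (3.15) p. 393, (3.35)–(3.37)
p. 396, Thm 3.1 (3.42) p. 397, Thm 3.3 p. 399, Thm 3.11 p. 416, (3.126) p. 420, (3.130) p. 421, (3.132)–(3.138) pp. 422–423; [Balaban1985Averaging] ([4]) Prop. 2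
(52)–(54) p. 26, (136)–(138) p. 39, (145) p. 39, (149) p. 40, (155) p. 41; [Balaban1984PropagatorsII] ([3]) (2.46) p. 231, (2.51)–(2.52) p. 232, Lemma 2.1 (2.61)
p. 234.  Composed BY NAME: «Y21» (one copy of its binder block per volume) and «Y19» §3.  Nothing of print is asserted here.

WHY THIS FILE («Y22»).  «Y20» plugged «Y18» into the socket with the consumer's display ∕ witnesses ((K81)'s block) as per-volume hypotheses; «Y21» derives
them on print's class.  THIS FILE = «Y21» ∘ «Y19» §3: **`exists_data190_tower_delta2_plaquette`** — «Y21»'s `∃ (α⋆, B, δ, A′, r₁, j₁, Λ)` FIRST; then for every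
height `k` (diagonal, weights, `c₀ = η^d`), cube side `M`, volume sequence `N`, size index set `I ∋ i₀`, source `(μ₀, w₀)`, and — PER VOLUME `n` — a
`unitaryUnits`-valued background `U n : Bond d (towerP L (N n·M)^d (k+1)) → 𝔸ˣ` in print's THREE WINDOWS (bond `αη`, plaquette `αη²`, bond-gradient `αη²`,
ONE `0 ≤ α ≤ α⋆` for all volumes) and the current window (3.36) `‖J‖ ≤ j₀ ≤ j₁`, geometry weights, rates `ρ + 5σ ≤ min(δ, r₁)∕d`, `c = c₀(1,σ)^d`, the derived
constants at «Y18»'s closed forms with `q, q_I < 1`, and a constant record `q′ : Consts190` under NUMERICS ONLY (`0 < q′.σ`, `δr > 0` with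
`c₀(δr, q′.σ∕δr)^d ≤ q′.cR`, `1 ≤ q′.κB`, `q′.δ15 ≤ 8ρ`, `A₀ + B_G̃θ_Dc ≤ q′.Cst`, `‖w₀‖ ≤ q′.m`, `q′.θ ≤ 1`): THERE ARE per-volume regularity displays
`αU n` with `hα1 hαL hU1 hreg` and positivity witnesses `hpos n` of `Δ_{a,k}(U n)` (DERIVED), families `Δ⁽²⁾ n`, `G′ n = (Δ_{a,k}(U n) − Δ⁽²⁾ n)⁻¹`,
`Inv′ n = (Q_kG′ nQ_k†)⁻¹` with the two-sided relations, the derivative family `T n = (H₁,k(U n) + G̃ nΔ⁽²⁾ nH₁,k(U n))ᵉ↾ℝ` (formula exported), AND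
`D : Data190 d M N (fun n => fine bond fields) q′` with `dHn := T` and the (4.35) computation rule
`D.hn n X̄ x = (b ↦ [unit-lattice site below b ∈ a cube of X̄] ? (T n (δ_{(ê x, μ₀)}·w₀))(b) : 0)`.  Mechanism: «Y21» per volume, `choose`, `HasMaj.mono`, «Y19» §3.

HONEST SCOPE.  [folklore] plumbing; NO estimate of [5], [15], [3], [4] or [I] is proved here.  A MODEL instance of NODE D of row (D4) on the one-domain tower
`Ω_k = T_η` of NE9's carriers (ONE level `j = k`; value line of (190) only; one unit source per unit-lattice site), EVERY operator Bałaban's on that model;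
DISPLAYED stay ONLY printed-shape letters: print's (3.35) read GLOBALLY on the torus (the fine-bond and gradient windows are not derived from the plaquette window:
non-contractible holonomies), the current window (3.36), the weight choice `c₀ = η^d` and `ρ_w`, [4] Prop. 5's smallnesses `(α₀, β)`, the Hilbert-structure
letters, the two smallnesses `q, q_I < 1` in `j₀`, and the numerics on `q′`; the rule holds for the display ∕ witness CHOSEN per volume (display-irrelevance of
`Δ⁽²⁾(U)` is not a tree theorem).  NOT Bałaban's multiscale `{Ω_j}`∕`𝔅` setting, NOT `Δ⁽²⁾_π` (3.135), NOT (3.138), NOT (189), NOT the other leaves of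
`PolLeavesT190` (`W`∕[II], the (4.4) seam, `han`∕`hrepr`, (5.1)∕(1.7)).  Row (D4) class UNCHANGED (instance 0∕1; critical-path width 0 = NODE O; D4 DISCHARGE
NO DATE); NOT B12 Thm 2, NOT BetaPertH, NOT continuum, NOT Clay.  HONEST DEPENDENCY (cell line): continuum YM on T⁴ ⇐ BetaPertH ∧ nine spine estimates (0/9
proved); BetaPertH ⇐ (D1) ∧ (D4) ∧ CAP+tail; G-an2-4 gates asym, D1 and NE2/3/4.  NEW file; nothing modified; 0 `def`; standard axioms; no `sorry`; default
heartbeats.  Net new unproved facts: 0.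
-/


noncomputable section

set_option autoImplicit false

open scoped BigOperators InnerProductSpace ComplexConjugate

namespace Literature.MathematicalPhysics.QuantumFieldTheory.Balaban1983to89.Beta.RemainderData190TowerDelta2Plaquette

open B11SectG B11SupSize190 open B9Eq311L2Pairing (WL2) open B4Sect5Torus (TSite) open B4Sect5Proof (latticeConst) open B5TorusCover (UT)
open B9Thm34Ext (toB6) open B9Thm37GlueTorus (torusGeom tdist1) open B9SectCLatticeCarrier (Bond bpos unshift) open B9Eq319QprimeTorus (blockCoord)
open B7Prop1Explicit (U1 Wcx boxVec) open B7Prop2Explicit (C0 c2') open B7Prop3Flat (c3) open B7Prop5GeneralLevels (thetaGen C3Gen)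
open B11Eq103H1Complex (SiteL2K BondL2K) open B9Eq310DeltaPrime (plaqHolU) open B9Eq310HessianOperator (adTransportW)
open B9Eq315QTorus (perCfg cornerSite) open B9Eq315QTower (towerP UlevOf) open B9Eq316TowerFlatIsOneStep (towerP_eq_fineP_pow siteCast)
open B9Eq326OperatorTower (QkW laplaceAk H1k) open B9Eq324DeltaPrimeATower (laplacePrimeAk) open B9Eq3119DeltaPiTower (laplaceAkPi)
open TreeLengthTorus (TPt TDom) open B12Decay510Torus (tcubeOf) open Beta.RemainderDecay190 (Data190 Consts190)
open B7Prop2Explicit (unitaryUnits) open Beta.RemainderOriginTowerDelta2Plaquette (exists_ineq190_origin_tower_delta2_plaquette)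
open Beta.RemainderData190TowerFlat (exists_data190_tower_of_ineq190)

section Tower

variable {d : ℕ} (hd : 1 ≤ d) (L : ℕ) [NeZero L] (hL : 1 ≤ L) (hL3 : 3 ≤ L)
  {𝔸 : Type*} [CStarAlgebra 𝔸] [Nontrivial 𝔸]
  {W : Type} [NormedAddCommGroup W] [InnerProductSpace ℂ W] [FiniteDimensional ℂ W] (φ : W ≃ₗ[ℂ] 𝔸)
  {Mφ Mφ' : ℝ} (hMφ : 0 ≤ Mφ) (hMφ' : 0 ≤ Mφ') (hφ : ∀ w, ‖φ w‖ ≤ Mφ * ‖w‖) (hφ' : ∀ X, ‖φ.symm X‖ ≤ Mφ' * ‖X‖)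
  {a : ℝ} (ha : 0 < a) {a' : ℝ} (ha' : 0 < a')
  (τ : 𝔸 →ₗ[ℂ] ℂ) {Cτ : ℝ} (hτ : ∀ X, ‖τ X‖ ≤ Cτ * ‖X‖) (hCτ : 0 ≤ Cτ) {Mτ : ℝ} (hτm : ∀ X Y : 𝔸, ‖τ (X * Y)‖ ≤ Mτ * ‖X‖ * ‖Y‖) (hMτ : 0 ≤ Mτ)
  {ρw : ℝ} (hρw : 0 ≤ ρw)
  (hτ₁ : ∀ X : 𝔸, τ (star X) = conj (τ X)) (hτ₂ : ∀ X Y : 𝔸, τ (X * Y) = τ (Y * X)) (hφτ : ∀ X Y : 𝔸, ⟪φ.symm X, φ.symm Y⟫_ℂ = τ (star X * Y))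
  (AQ : ℝ)
  (hAQ16 : 16 * ((d : ℝ) + 1) * ((d : ℝ) + 4) * c2' d L ≤ AQ)
  {α₀ β : ℝ} (hα : 0 < α₀) (hα3 : C0 d * α₀ ≤ 1 / 3) (hα4 : 4 * α₀ ≤ c2' d L) (hβ : 0 < β)
  (hsmall : Real.exp (4 * (800 * ((d : ℝ) + 1) ^ 2 * ((d : ℝ) + 4)) * α₀) * (1 + 8 * (131072 * ((d : ℝ) + 1) ^ 2) * β) ≤ 2)
  (hc₃ : 4 * β < c3 d L)
  (h145 : 8 * d * thetaGen d L α₀ * (L : ℝ)⁻¹ ^ 4 ≤ 1)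
  (h155 : (2 * (L : ℝ) - 1) * (L : ℝ)⁻¹ ^ 2 + 2 * d * thetaGen d L α₀ * (L : ℝ)⁻¹ ^ 3
    + 1 / 8 * (1 + 2 * d * thetaGen d L α₀ * (L : ℝ)⁻¹ ^ 2 + 2 * d * C3Gen d L * β) * (L : ℝ)⁻¹ ^ 2 ≤ 1)

include hd hL hL3 hMφ hMφ' hφ hφ' ha ha' hτ hCτ hτm hMτ hρw hτ₁ hτ₂ hφτ hAQ16 hα hα3 hα4 hβ hsmall hc₃ h145 h155 in
/-- **THE (190)-SOCKET OF ROW (D4) INHABITED IN A BACKGROUND FIELD OF PRINT's CLASS, `Δ⁽²⁾(U)` BUILT IN, DISPLAY ∕ WITNESSES DERIVED** — see the module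
docstring: «Y21»'s `∃ (α⋆, B, δ, A′, r₁, j₁, Λ)` first; per volume `n` a `unitaryUnits`-valued background `U n` in the three windows (one `α ≤ α⋆`) and the
current window (`j₀ ≤ j₁`); the rates, the derived constants with the two smallnesses in `j₀`, numerics on `q′`: per-volume displays ∕ witnesses (derived),
families `Δ⁽²⁾ n`, `G′ n`, `Inv′ n` (two-sided), `T n = (H₁,k(U n) + G̃ nΔ⁽²⁾ nH₁,k(U n))ᵉ↾ℝ`, and `D : Data190 d M N (fine bond fields) q′` with `dHn := T` and
the (4.35) rule. [cite: Balaban1987RG1, (4.4) p.281, p.282, (4.35) p.290] [cite: Balaban1985Variational, (182) p.307, (190) p.308, (129)–(131) pp.297–298, (180) p.306]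
[cite: Balaban1985BackgroundPropagators, (3.134)–(3.138) pp.422–423, (3.126) p.420, (3.132)–(3.133) p.422, Thm 3.11 p.416, (3.35)–(3.37) p.396]
[cite: Balaban1985Averaging, (136)–(138) p.39, (149) p.40, Prop. 2 (52)–(54) p.26] [cite: Balaban1984PropagatorsII, (2.51)–(2.52) p.232, Lemma 2.1 (2.61) p.234] -/
theorem exists_data190_tower_delta2_plaquette :
    ∃ αs B δ A' r₁ j₁ Λ : ℝ, 0 < αs ∧ 0 ≤ B ∧ 0 < δ ∧ 0 ≤ A' ∧ 0 < r₁ ∧ 0 < j₁ ∧ 0 ≤ Λ ∧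
      ∀ (k : ℕ) (η : ℝ) (_hηL : η * (L : ℝ) ^ (k + 1) = 1) (c₀ c₁ : ℝ) [Fact (0 < c₀)] [Fact (0 < c₁)]
        (_hw : c₀ * ((L : ℝ) ^ (k + 1)) ^ d = c₁) (_hρ : |η| ^ d / c₀ ≤ ρw) (_hc₀η : c₀ = η ^ d)
        (M : ℕ) [NeZero M] (N : ℕ → ℕ) [∀ n, NeZero (N n)] (I : Type) (_i₀ : I) (μ₀ : Fin d) (w₀ : W)
        -- PER VOLUME `n`: a `unitaryUnits`-valued background on the fine torus above the unit lattice with `N n·M` sites per direction, in print's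
        -- three windows (3.35) with ONE `α` and the current window (3.36) with ONE `j₀` for all volumes
        (U : (n : ℕ) → Bond d (towerP L (fun _ : Fin d => N n * M) (k + 1)) → 𝔸ˣ) (_hUu : ∀ n b, U n b ∈ unitaryUnits 𝔸)
        (α : ℝ) (_hα : 0 ≤ α) (_hαle : α ≤ αs) (_hUη : ∀ n b, ‖(U n b : 𝔸) - 1‖ ≤ α * η)
        (_hpl : ∀ n (p : B9SectCLatticeCarrier.Plaq d (towerP L (fun _ : Fin d => N n * M) (k + 1))), ‖(plaqHolU (U n) p : 𝔸) - 1‖ ≤ α * η ^ 2)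
        (_hUgrad : ∀ n (x : TSite d (towerP L (fun _ : Fin d => N n * M) (k + 1))) (μ : Fin d), ‖(U n (x, μ) : 𝔸) - U n (unshift μ x, μ)‖ ≤ α * η ^ 2)
        (j₀ : ℝ) (_hJ : ∀ n μ y, ‖B9Eq39Adjoint.J (fun μ => B9Eq33CovDerivVector.shiftEquiv μ) (fun μ y => U n (y, μ)) η μ y‖ ≤ j₀) (_hj : j₀ ≤ j₁)
        (η₀ L₀ M₀ R : ℕ → ℝ) (H : ℕ → Prop)
        -- the rates and the (free) row-sum constant (as in «Y18»)
        (ρ σ c : ℝ) (_hσ : 0 < σ) (_hρ0 : 0 ≤ ρ) (_hρ₁ : ρ + 5 * σ ≤ δ / d) (_hρI : ρ + 5 * σ ≤ r₁ / d) (_hc_def : c = B6.c0 1 σ ^ d)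
    -- the derived constants at their closed forms (instantiate with `rfl`) and the TWO smallnesses in `j₀` (as in «Y18»)
    {qN BG' θP qI BI' A₀ θD BGt : ℝ}
    (hq_def : qN = B * ((Λ * j₀) * Real.exp (σ * d) * c) * Real.exp (δ / d * d) * c) (hq : qN < 1) (hBG' : BG' = B * (1 - qN)⁻¹)
    (hθP : θP = B * ((Λ * j₀) * Real.exp (σ * d) * c) * Real.exp (δ / d * d) * BG' * c *
      ((Mφ' * Real.exp (100 * d * (d + 1) * (L : ℝ) ^ d * AQ) * Mφ * ((2 * d : ℕ) : ℝ)) * Real.exp 1 * latticeConst d 1) *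
      Real.exp ((ρ + 4 * σ) * d) * ((Mφ' * Mφ * Real.exp (50 * (d + 1) * AQ)) * Real.exp 1 * latticeConst d 1) *
      Real.exp ((ρ + 4 * σ) * d))
    (hqI : qI = A' * θP * c * c) (hqI1 : qI < 1) (hBI' : BI' = A' * (1 - qI)⁻¹)
    (hA₀ : A₀ = B * ((Mφ' * Real.exp (100 * d * (d + 1) * (L : ℝ) ^ d * AQ) * Mφ * ((2 * d : ℕ) : ℝ)) * Real.exp 1 *
      latticeConst d 1) * Real.exp δ * A' * c)
    (hθD : θD = A₀ * ((Λ * j₀) * Real.exp (σ * d) * c) * Real.exp (ρ * d))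
    (hBGt : BGt = BG' + ((Mφ' * Mφ * Real.exp (50 * (d + 1) * AQ)) * Real.exp 1 * latticeConst d 1) *
      ((Mφ' * Real.exp (100 * d * (d + 1) * (L : ℝ) ^ d * AQ) * Mφ * ((2 * d : ℕ) : ℝ)) * Real.exp 1 * latticeConst d 1) *
      BI' * BG' * BG' * Real.exp ((ρ + 2 * σ) * d) * Real.exp ((ρ + 2 * σ) * d) * c * c)
    -- the socket's constant record: numerics only
    (q' : Consts190) (δr : ℝ) (_hδr : 0 < δr) (_hσ₀ : 0 < q'.σ) (_hcR : B6.c0 δr (q'.σ / δr) ^ d ≤ q'.cR) (_hκB : 1 ≤ q'.κB)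
    (_hδ15 : q'.δ15 ≤ 8 * ρ) (_hCst : A₀ + BGt * θD * c ≤ q'.Cst) (_hm : ‖w₀‖ ≤ q'.m) (_hθ1 : q'.θ ≤ 1),
    ∃ (αU : ℕ → ℕ → ℝ) (hα1 : ∀ n j, αU n j ≤ 1 / 64) (hαL : ∀ n j, 50 * (d + 1) * αU n j * (L : ℝ) ^ d ≤ 1 / 2)
      (hU1 : ∀ (n j : ℕ) (x : B7Prop1Explicit.Site d) (κ : Fin d), perCfg (towerP L (fun _ : Fin d => N n * M) (j + 1)) (UlevOf L (fun _ : Fin d => N n * M) (k + 1) (U n) j) x κ ∈ U1 𝔸)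
      (hreg : ∀ (n j : ℕ) (y : TSite d (towerP L (fun _ : Fin d => N n * M) j)) (κ : Fin d) (ρ' : Fin d → Fin L),
        ‖((Wcx L (perCfg (towerP L (fun _ : Fin d => N n * M) (j + 1)) (UlevOf L (fun _ : Fin d => N n * M) (k + 1) (U n) j)) (cornerSite L y) κ (boxVec L ρ') : 𝔸ˣ) : 𝔸) - 1‖ ≤ αU n j)
      (hpos : ∀ n (x : BondL2K ℂ d (towerP L (fun _ : Fin d => N n * M) (k + 1)) c₀ W), x ≠ 0 →
        0 < RCLike.re ⟪x, laplaceAk L (fun _ : Fin d => N n * M) k φ η (U n) hL (αU n) (hα1 n) (hU1 n) (hreg n) τ (c₀ := c₀) (c₁ := c₁) a x⟫_ℂ),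
    ∃ (D2 : (n : ℕ) → BondL2K ℂ d (towerP L (fun _ : Fin d => N n * M) (k + 1)) c₀ W →ₗ[ℂ] BondL2K ℂ d (towerP L (fun _ : Fin d => N n * M) (k + 1)) c₀ W)
      (G' : (n : ℕ) → (Bond d (towerP L (fun _ : Fin d => N n * M) (k + 1)) → W) →L[ℂ] (Bond d (towerP L (fun _ : Fin d => N n * M) (k + 1)) → W))
      (Inv' : (n : ℕ) → (Bond d (fun _ : Fin d => N n * M) → W) →L[ℂ] (Bond d (fun _ : Fin d => N n * M) → W))
      (T : (n : ℕ) → (Bond d (fun _ : Fin d => N n * M) → W) →ₗ[ℝ] (Bond d (towerP L (fun _ : Fin d => N n * M) (k + 1)) → W)),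
      (∀ n : ℕ,
      -- `G′ = (Δ_{a,k}(U) − Δ⁽²⁾)⁻¹`, two-sided
      G' n * (LinearMap.toContinuousLinearMap
          ((WL2.linearEquiv ℂ ℂ (fun _ : Bond d (towerP L (fun _ : Fin d => N n * M) (k + 1)) => c₀) :
              BondL2K ℂ d (towerP L (fun _ : Fin d => N n * M) (k + 1)) c₀ W ≃ₗ[ℂ] (Bond d (towerP L (fun _ : Fin d => N n * M) (k + 1)) → W)).toLinearMap ∘ₗ
            laplaceAk L (fun _ : Fin d => N n * M) k φ η (U n) hL (αU n) (hα1 n) (hU1 n) (hreg n) τ (c₀ := c₀) (c₁ := c₁) a ∘ₗ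
            (WL2.linearEquiv ℂ ℂ (fun _ : Bond d (towerP L (fun _ : Fin d => N n * M) (k + 1)) => c₀) :
              BondL2K ℂ d (towerP L (fun _ : Fin d => N n * M) (k + 1)) c₀ W ≃ₗ[ℂ] (Bond d (towerP L (fun _ : Fin d => N n * M) (k + 1)) → W)).symm.toLinearMap) -
        LinearMap.toContinuousLinearMap
          ((WL2.linearEquiv ℂ ℂ (fun _ : Bond d (towerP L (fun _ : Fin d => N n * M) (k + 1)) => c₀) :
              BondL2K ℂ d (towerP L (fun _ : Fin d => N n * M) (k + 1)) c₀ W ≃ₗ[ℂ] (Bond d (towerP L (fun _ : Fin d => N n * M) (k + 1)) → W)).toLinearMap ∘ₗ D2 n ∘ₗ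
            (WL2.linearEquiv ℂ ℂ (fun _ : Bond d (towerP L (fun _ : Fin d => N n * M) (k + 1)) => c₀) :
              BondL2K ℂ d (towerP L (fun _ : Fin d => N n * M) (k + 1)) c₀ W ≃ₗ[ℂ] (Bond d (towerP L (fun _ : Fin d => N n * M) (k + 1)) → W)).symm.toLinearMap)) = 1 ∧
      (LinearMap.toContinuousLinearMap
          ((WL2.linearEquiv ℂ ℂ (fun _ : Bond d (towerP L (fun _ : Fin d => N n * M) (k + 1)) => c₀) :
              BondL2K ℂ d (towerP L (fun _ : Fin d => N n * M) (k + 1)) c₀ W ≃ₗ[ℂ] (Bond d (towerP L (fun _ : Fin d => N n * M) (k + 1)) → W)).toLinearMap ∘ₗ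
            laplaceAk L (fun _ : Fin d => N n * M) k φ η (U n) hL (αU n) (hα1 n) (hU1 n) (hreg n) τ (c₀ := c₀) (c₁ := c₁) a ∘ₗ
            (WL2.linearEquiv ℂ ℂ (fun _ : Bond d (towerP L (fun _ : Fin d => N n * M) (k + 1)) => c₀) :
              BondL2K ℂ d (towerP L (fun _ : Fin d => N n * M) (k + 1)) c₀ W ≃ₗ[ℂ] (Bond d (towerP L (fun _ : Fin d => N n * M) (k + 1)) → W)).symm.toLinearMap) -
        LinearMap.toContinuousLinearMap
          ((WL2.linearEquiv ℂ ℂ (fun _ : Bond d (towerP L (fun _ : Fin d => N n * M) (k + 1)) => c₀) :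
              BondL2K ℂ d (towerP L (fun _ : Fin d => N n * M) (k + 1)) c₀ W ≃ₗ[ℂ] (Bond d (towerP L (fun _ : Fin d => N n * M) (k + 1)) → W)).toLinearMap ∘ₗ D2 n ∘ₗ
            (WL2.linearEquiv ℂ ℂ (fun _ : Bond d (towerP L (fun _ : Fin d => N n * M) (k + 1)) => c₀) :
              BondL2K ℂ d (towerP L (fun _ : Fin d => N n * M) (k + 1)) c₀ W ≃ₗ[ℂ] (Bond d (towerP L (fun _ : Fin d => N n * M) (k + 1)) → W)).symm.toLinearMap)) * G' n = 1 ∧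
      -- `Inv′ = (Q_kG′Q_k†)⁻¹`, two-sided
      Inv' n * ((LinearMap.toContinuousLinearMap
          ((WL2.linearEquiv ℂ ℂ (fun _ : Bond d (fun _ : Fin d => N n * M) => c₁) : BondL2K ℂ d (fun _ : Fin d => N n * M) c₁ W ≃ₗ[ℂ] (Bond d (fun _ : Fin d => N n * M) → W)).toLinearMap ∘ₗ
            QkW L (fun _ : Fin d => N n * M) k φ (U n) hL (αU n) (hα1 n) (hU1 n) (hreg n) (c₀ := c₀) (c₁ := c₁) ∘ₗ
            (WL2.linearEquiv ℂ ℂ (fun _ : Bond d (towerP L (fun _ : Fin d => N n * M) (k + 1)) => c₀) :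
              BondL2K ℂ d (towerP L (fun _ : Fin d => N n * M) (k + 1)) c₀ W ≃ₗ[ℂ] (Bond d (towerP L (fun _ : Fin d => N n * M) (k + 1)) → W)).symm.toLinearMap)).comp
        ((G' n).comp (LinearMap.toContinuousLinearMap
          ((WL2.linearEquiv ℂ ℂ (fun _ : Bond d (towerP L (fun _ : Fin d => N n * M) (k + 1)) => c₀) :
              BondL2K ℂ d (towerP L (fun _ : Fin d => N n * M) (k + 1)) c₀ W ≃ₗ[ℂ] (Bond d (towerP L (fun _ : Fin d => N n * M) (k + 1)) → W)).toLinearMap ∘ₗ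
            LinearMap.adjoint (QkW L (fun _ : Fin d => N n * M) k φ (U n) hL (αU n) (hα1 n) (hU1 n) (hreg n) (c₀ := c₀) (c₁ := c₁)) ∘ₗ
            (WL2.linearEquiv ℂ ℂ (fun _ : Bond d (fun _ : Fin d => N n * M) => c₁) : BondL2K ℂ d (fun _ : Fin d => N n * M) c₁ W ≃ₗ[ℂ] (Bond d (fun _ : Fin d => N n * M) → W)).symm.toLinearMap)))) = 1 ∧
      ((LinearMap.toContinuousLinearMap
          ((WL2.linearEquiv ℂ ℂ (fun _ : Bond d (fun _ : Fin d => N n * M) => c₁) : BondL2K ℂ d (fun _ : Fin d => N n * M) c₁ W ≃ₗ[ℂ] (Bond d (fun _ : Fin d => N n * M) → W)).toLinearMap ∘ₗ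
            QkW L (fun _ : Fin d => N n * M) k φ (U n) hL (αU n) (hα1 n) (hU1 n) (hreg n) (c₀ := c₀) (c₁ := c₁) ∘ₗ
            (WL2.linearEquiv ℂ ℂ (fun _ : Bond d (towerP L (fun _ : Fin d => N n * M) (k + 1)) => c₀) :
              BondL2K ℂ d (towerP L (fun _ : Fin d => N n * M) (k + 1)) c₀ W ≃ₗ[ℂ] (Bond d (towerP L (fun _ : Fin d => N n * M) (k + 1)) → W)).symm.toLinearMap)).comp
        ((G' n).comp (LinearMap.toContinuousLinearMap
          ((WL2.linearEquiv ℂ ℂ (fun _ : Bond d (towerP L (fun _ : Fin d => N n * M) (k + 1)) => c₀) :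
              BondL2K ℂ d (towerP L (fun _ : Fin d => N n * M) (k + 1)) c₀ W ≃ₗ[ℂ] (Bond d (towerP L (fun _ : Fin d => N n * M) (k + 1)) → W)).toLinearMap ∘ₗ
            LinearMap.adjoint (QkW L (fun _ : Fin d => N n * M) k φ (U n) hL (αU n) (hα1 n) (hU1 n) (hreg n) (c₀ := c₀) (c₁ := c₁)) ∘ₗ
            (WL2.linearEquiv ℂ ℂ (fun _ : Bond d (fun _ : Fin d => N n * M) => c₁) : BondL2K ℂ d (fun _ : Fin d => N n * M) c₁ W ≃ₗ[ℂ] (Bond d (fun _ : Fin d => N n * M) → W)).symm.toLinearMap)))) * Inv' n = 1 ∧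
      -- the derivative family: [15] (182) at the origin, `T n = (H₀ + G̃Δ⁽²⁾H₀)ᵉ↾ℝ` with `H₀ = H₁,k(U n)`, `G̃ = G′ − G′Q_k†·Inv′·Q_kG′`
      T n =
          ((((WL2.linearEquiv ℂ ℂ (fun _ : Bond d (towerP L (fun _ : Fin d => N n * M) (k + 1)) => c₀) :
                  BondL2K ℂ d (towerP L (fun _ : Fin d => N n * M) (k + 1)) c₀ W ≃ₗ[ℂ] (Bond d (towerP L (fun _ : Fin d => N n * M) (k + 1)) → W)).toLinearMap ∘ₗ
              H1k L (fun _ : Fin d => N n * M) k φ η (U n) hL (αU n) (hα1 n) (hU1 n) (hreg n) τ (c₀ := c₀) (c₁ := c₁) (hαL n) (hpos n) ∘ₗ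
              (WL2.linearEquiv ℂ ℂ (fun _ : Bond d (fun _ : Fin d => N n * M) => c₁) : BondL2K ℂ d (fun _ : Fin d => N n * M) c₁ W ≃ₗ[ℂ] (Bond d (fun _ : Fin d => N n * M) → W)).symm.toLinearMap).restrictScalars ℝ) +
            (((G' n).restrictScalars ℝ : (Bond d (towerP L (fun _ : Fin d => N n * M) (k + 1)) → W) →ₗ[ℝ] (Bond d (towerP L (fun _ : Fin d => N n * M) (k + 1)) → W)) -
              (((G' n).restrictScalars ℝ : (Bond d (towerP L (fun _ : Fin d => N n * M) (k + 1)) → W) →ₗ[ℝ] (Bond d (towerP L (fun _ : Fin d => N n * M) (k + 1)) → W)) ∘ₗ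
                (((WL2.linearEquiv ℂ ℂ (fun _ : Bond d (towerP L (fun _ : Fin d => N n * M) (k + 1)) => c₀) :
                      BondL2K ℂ d (towerP L (fun _ : Fin d => N n * M) (k + 1)) c₀ W ≃ₗ[ℂ] (Bond d (towerP L (fun _ : Fin d => N n * M) (k + 1)) → W)).toLinearMap ∘ₗ
                  LinearMap.adjoint (QkW L (fun _ : Fin d => N n * M) k φ (U n) hL (αU n) (hα1 n) (hU1 n) (hreg n) (c₀ := c₀) (c₁ := c₁)) ∘ₗ
                  (WL2.linearEquiv ℂ ℂ (fun _ : Bond d (fun _ : Fin d => N n * M) => c₁) : BondL2K ℂ d (fun _ : Fin d => N n * M) c₁ W ≃ₗ[ℂ] (Bond d (fun _ : Fin d => N n * M) → W)).symm.toLinearMap).restrictScalars ℝ)) ∘ₗ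
              ((Inv' n).restrictScalars ℝ : (Bond d (fun _ : Fin d => N n * M) → W) →ₗ[ℝ] (Bond d (fun _ : Fin d => N n * M) → W)) ∘ₗ
              ((((WL2.linearEquiv ℂ ℂ (fun _ : Bond d (fun _ : Fin d => N n * M) => c₁) : BondL2K ℂ d (fun _ : Fin d => N n * M) c₁ W ≃ₗ[ℂ] (Bond d (fun _ : Fin d => N n * M) → W)).toLinearMap ∘ₗ
                  QkW L (fun _ : Fin d => N n * M) k φ (U n) hL (αU n) (hα1 n) (hU1 n) (hreg n) (c₀ := c₀) (c₁ := c₁) ∘ₗ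
                  (WL2.linearEquiv ℂ ℂ (fun _ : Bond d (towerP L (fun _ : Fin d => N n * M) (k + 1)) => c₀) :
                    BondL2K ℂ d (towerP L (fun _ : Fin d => N n * M) (k + 1)) c₀ W ≃ₗ[ℂ] (Bond d (towerP L (fun _ : Fin d => N n * M) (k + 1)) → W)).symm.toLinearMap).restrictScalars ℝ) ∘ₗ
                ((G' n).restrictScalars ℝ : (Bond d (towerP L (fun _ : Fin d => N n * M) (k + 1)) → W) →ₗ[ℝ] (Bond d (towerP L (fun _ : Fin d => N n * M) (k + 1)) → W)))) ∘ₗ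
            ((((WL2.linearEquiv ℂ ℂ (fun _ : Bond d (towerP L (fun _ : Fin d => N n * M) (k + 1)) => c₀) :
                    BondL2K ℂ d (towerP L (fun _ : Fin d => N n * M) (k + 1)) c₀ W ≃ₗ[ℂ] (Bond d (towerP L (fun _ : Fin d => N n * M) (k + 1)) → W)).toLinearMap ∘ₗ D2 n ∘ₗ
                (WL2.linearEquiv ℂ ℂ (fun _ : Bond d (towerP L (fun _ : Fin d => N n * M) (k + 1)) => c₀) :
                  BondL2K ℂ d (towerP L (fun _ : Fin d => N n * M) (k + 1)) c₀ W ≃ₗ[ℂ] (Bond d (towerP L (fun _ : Fin d => N n * M) (k + 1)) → W)).symm.toLinearMap).restrictScalars ℝ) ∘ₗ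
              (((WL2.linearEquiv ℂ ℂ (fun _ : Bond d (towerP L (fun _ : Fin d => N n * M) (k + 1)) => c₀) :
                    BondL2K ℂ d (towerP L (fun _ : Fin d => N n * M) (k + 1)) c₀ W ≃ₗ[ℂ] (Bond d (towerP L (fun _ : Fin d => N n * M) (k + 1)) → W)).toLinearMap ∘ₗ
                H1k L (fun _ : Fin d => N n * M) k φ η (U n) hL (αU n) (hα1 n) (hU1 n) (hreg n) τ (c₀ := c₀) (c₁ := c₁) (hαL n) (hpos n) ∘ₗ
                (WL2.linearEquiv ℂ ℂ (fun _ : Bond d (fun _ : Fin d => N n * M) => c₁) : BondL2K ℂ d (fun _ : Fin d => N n * M) c₁ W ≃ₗ[ℂ] (Bond d (fun _ : Fin d => N n * M) → W)).symm.toLinearMap).restrictScalars ℝ)))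
      ) ∧
      ∃ D : Data190 d M N (fun n => Bond d (towerP L (fun _ : Fin d => N n * M) (k + 1)) → W) q',
        ∀ (n : ℕ) (X : TDom d (N n)) (x : TPt d (N n * M)),
          D.hn n X x = fun b : Bond d (towerP L (fun _ : Fin d => N n * M) (k + 1)) =>
            if tcubeOf (N n) M (fun i => ((blockCoord (L ^ (k + 1)) (fun _ : Fin d => N n * M) (siteCast (towerP_eq_fineP_pow L (fun _ : Fin d => N n * M) (k + 1)) (bpos b)) i : ℕ) :
                ZMod (N n * M))) ∈ X.1 then
              T n (Pi.single ((fun i => (⟨(x i).val, ZMod.val_lt (x i)⟩ : Fin (N n * M))), μ₀) w₀) b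
            else 0 := by
  obtain ⟨αs, B, δ, A', r₁, j₁, Λ, hαs, hB, hδ, hA', hr₁, hj₁, hΛ, HY⟩ :=
    exists_ineq190_origin_tower_delta2_plaquette hd L hL hL3 φ hMφ hMφ' hφ hφ' ha ha' τ hτ hCτ hτm hMτ hρw hτ₁ hτ₂ hφτ AQ hAQ16 hα hα3 hα4 hβ hsmall
      hc₃ h145 h155
  refine ⟨αs, B, δ, A', r₁, j₁, Λ, hαs, hB, hδ, hA', hr₁, hj₁, hΛ, ?_⟩
  intro k η hηL c₀ c₁ _ _ hw hρ hc₀η M _ N _ I i₀ μ₀ w₀ U hUu α hα' hαle hUη hpl hUgrad j₀ hJ hj η₀ L₀ M₀ R H ρ σ c hσ hρ0 hρ₁ hρI hc_def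
    qN BG' θP qI BI' A₀ θD BGt hq_def hq hBG' hθP hqI hqI1 hBI' hA₀ hθD hBGt q' δr hδr hσ₀ hcR hκB hδ15 hCst hm hθ1
  have hmN : ∀ n, ∀ i : Fin d, 1 ≤ (fun _ : Fin d => N n * M) i := fun n _ => Nat.pos_of_neZero _
  -- «Y21» per volume, then `choose`
  have HYn := fun n => HY k η hηL c₀ c₁ hw hρ hc₀η (fun _ : Fin d => N n * M) (hmN n) (U n) (hUu n) α hα' hαle (hUη n) (hpl n) (hUgrad n) j₀ (hJ n) hj
    (η₀ n) (L₀ n) (M₀ n) (R n) (H n) ρ σ c hσ hρ0 hρ₁ hρI hc_def hq_def hq hBG' hθP hqI hqI1 hBI' hA₀ hθD hBGt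
  choose αU hα1 hαL hU1 hreg hpos D2 G' Inv' h1 h2 h3 h4 h5 using HYn
  have hδ8 : q'.δ15 / 8 ≤ ρ := by linarith
  refine ⟨αU, hα1, hαL, hU1, hreg, hpos, D2, G', Inv', fun n =>
          ((((WL2.linearEquiv ℂ ℂ (fun _ : Bond d (towerP L (fun _ : Fin d => N n * M) (k + 1)) => c₀) :
                  BondL2K ℂ d (towerP L (fun _ : Fin d => N n * M) (k + 1)) c₀ W ≃ₗ[ℂ] (Bond d (towerP L (fun _ : Fin d => N n * M) (k + 1)) → W)).toLinearMap ∘ₗ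
              H1k L (fun _ : Fin d => N n * M) k φ η (U n) hL (αU n) (hα1 n) (hU1 n) (hreg n) τ (c₀ := c₀) (c₁ := c₁) (hαL n) (hpos n) ∘ₗ
              (WL2.linearEquiv ℂ ℂ (fun _ : Bond d (fun _ : Fin d => N n * M) => c₁) : BondL2K ℂ d (fun _ : Fin d => N n * M) c₁ W ≃ₗ[ℂ] (Bond d (fun _ : Fin d => N n * M) → W)).symm.toLinearMap).restrictScalars ℝ) +
            (((G' n).restrictScalars ℝ : (Bond d (towerP L (fun _ : Fin d => N n * M) (k + 1)) → W) →ₗ[ℝ] (Bond d (towerP L (fun _ : Fin d => N n * M) (k + 1)) → W)) -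
              (((G' n).restrictScalars ℝ : (Bond d (towerP L (fun _ : Fin d => N n * M) (k + 1)) → W) →ₗ[ℝ] (Bond d (towerP L (fun _ : Fin d => N n * M) (k + 1)) → W)) ∘ₗ
                (((WL2.linearEquiv ℂ ℂ (fun _ : Bond d (towerP L (fun _ : Fin d => N n * M) (k + 1)) => c₀) :
                      BondL2K ℂ d (towerP L (fun _ : Fin d => N n * M) (k + 1)) c₀ W ≃ₗ[ℂ] (Bond d (towerP L (fun _ : Fin d => N n * M) (k + 1)) → W)).toLinearMap ∘ₗ
                  LinearMap.adjoint (QkW L (fun _ : Fin d => N n * M) k φ (U n) hL (αU n) (hα1 n) (hU1 n) (hreg n) (c₀ := c₀) (c₁ := c₁)) ∘ₗ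
                  (WL2.linearEquiv ℂ ℂ (fun _ : Bond d (fun _ : Fin d => N n * M) => c₁) : BondL2K ℂ d (fun _ : Fin d => N n * M) c₁ W ≃ₗ[ℂ] (Bond d (fun _ : Fin d => N n * M) → W)).symm.toLinearMap).restrictScalars ℝ)) ∘ₗ
              ((Inv' n).restrictScalars ℝ : (Bond d (fun _ : Fin d => N n * M) → W) →ₗ[ℝ] (Bond d (fun _ : Fin d => N n * M) → W)) ∘ₗ
              ((((WL2.linearEquiv ℂ ℂ (fun _ : Bond d (fun _ : Fin d => N n * M) => c₁) : BondL2K ℂ d (fun _ : Fin d => N n * M) c₁ W ≃ₗ[ℂ] (Bond d (fun _ : Fin d => N n * M) → W)).toLinearMap ∘ₗ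
                  QkW L (fun _ : Fin d => N n * M) k φ (U n) hL (αU n) (hα1 n) (hU1 n) (hreg n) (c₀ := c₀) (c₁ := c₁) ∘ₗ
                  (WL2.linearEquiv ℂ ℂ (fun _ : Bond d (towerP L (fun _ : Fin d => N n * M) (k + 1)) => c₀) :
                    BondL2K ℂ d (towerP L (fun _ : Fin d => N n * M) (k + 1)) c₀ W ≃ₗ[ℂ] (Bond d (towerP L (fun _ : Fin d => N n * M) (k + 1)) → W)).symm.toLinearMap).restrictScalars ℝ) ∘ₗ
                ((G' n).restrictScalars ℝ : (Bond d (towerP L (fun _ : Fin d => N n * M) (k + 1)) → W) →ₗ[ℝ] (Bond d (towerP L (fun _ : Fin d => N n * M) (k + 1)) → W)))) ∘ₗ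
            ((((WL2.linearEquiv ℂ ℂ (fun _ : Bond d (towerP L (fun _ : Fin d => N n * M) (k + 1)) => c₀) :
                    BondL2K ℂ d (towerP L (fun _ : Fin d => N n * M) (k + 1)) c₀ W ≃ₗ[ℂ] (Bond d (towerP L (fun _ : Fin d => N n * M) (k + 1)) → W)).toLinearMap ∘ₗ D2 n ∘ₗ
                (WL2.linearEquiv ℂ ℂ (fun _ : Bond d (towerP L (fun _ : Fin d => N n * M) (k + 1)) => c₀) :
                  BondL2K ℂ d (towerP L (fun _ : Fin d => N n * M) (k + 1)) c₀ W ≃ₗ[ℂ] (Bond d (towerP L (fun _ : Fin d => N n * M) (k + 1)) → W)).symm.toLinearMap).restrictScalars ℝ) ∘ₗ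
              (((WL2.linearEquiv ℂ ℂ (fun _ : Bond d (towerP L (fun _ : Fin d => N n * M) (k + 1)) => c₀) :
                    BondL2K ℂ d (towerP L (fun _ : Fin d => N n * M) (k + 1)) c₀ W ≃ₗ[ℂ] (Bond d (towerP L (fun _ : Fin d => N n * M) (k + 1)) → W)).toLinearMap ∘ₗ
                H1k L (fun _ : Fin d => N n * M) k φ η (U n) hL (αU n) (hα1 n) (hU1 n) (hreg n) τ (c₀ := c₀) (c₁ := c₁) (hαL n) (hpos n) ∘ₗ
                (WL2.linearEquiv ℂ ℂ (fun _ : Bond d (fun _ : Fin d => N n * M) => c₁) : BondL2K ℂ d (fun _ : Fin d => N n * M) c₁ W ≃ₗ[ℂ] (Bond d (fun _ : Fin d => N n * M) → W)).symm.toLinearMap).restrictScalars ℝ)))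
    , fun n => ⟨h1 n, h2 n, h3 n, h4 n, rfl⟩, ?_⟩
  exact exists_data190_tower_of_ineq190 L k M N I i₀ η₀ L₀ M₀ R H μ₀ w₀ q' _
    (fun n => ((h5 n) q'.δ15 hδ8).mono fun y v => mul_le_mul_of_nonneg_right hCst (Real.exp_pos _).le) hδr hσ₀ hcR hκB hm hθ1

end Tower

end Literature.MathematicalPhysics.QuantumFieldTheory.Balaban1983to89.Beta.RemainderData190TowerDelta2Plaquette

end
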